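import Summits.ResolutionOfSingularities.ResolutionOfSingularities.Theorems.EquisingularLiftEquisingularLiftNatMemberSAtStepSingular
import Summits.ResolutionOfSingularities.ResolutionOfSingularities.Theorems.EquisingularLiftEquisingularLiftNatMemberSLStepRegular
import HarnessLib

/-!
# [OURS · L1 W4.5(b) · EL♮(3) · T23-A‴ (U6)] THE CENTRED IN-CARRIER POINT STEP WITH LETTERS: `memberSL_strictTransform_of_centredPoint`
# (rule (D‴5′) of res-L1-w45b-stub-4's ENGINE WORD v1.1 f996922ad41a17f2; downstairs menu = res-L1-w45b-lead-2's `InCarrierReachKSs` 0c6a341d172f5c17)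

res-type-027 g18 ((U6) owner), brick (F5b). OURS; NOT a statement of any manuscript ([Hironaka2017] is a candidate under adjudication, nothing of
it is asserted); AI-written, weaker than expert review. No `sorry`; standard axioms; DEF-FREE; `--supports stmt-ResolutionOfSingularities-20148 --as helper`.

WHAT. The twin of `memberSL_strictTransform_of_regularPoint` (…NatMemberSLStepRegular) at the CENTRED point `x` (the `{x}`-member, package clause
(vi)): carrier plane / `𝓢` / `K` by rule (b) = res-type-027's (C)S `memberSAt_strictTransform_of_centredPoint` (p627303; engine (C)/K3″: res-L1-w45b-stub-4
/ -stub-1 / res-D-pv-029) with the PACKAGE section; the new plane `υ⁻¹{x}` born with its model (`TCPlus.letterDatum_newPlane`, `G` regular at `x` =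
`hamb`); away letters keep their models (rule (a), p626721); letters through `x` dropped (rule (c′)). Menu form as in the regular twin; new `excl = ∅`.
[cite: GortzWedhorn2020, Prop. 13.91 and (13.19)] [cite: Liu2002, Thm. 8.1.19] [cite: Matsumura1987, Thm. 14.2] [cite: StacksProject, Tag 01WS]
-/

set_option linter.dupNamespace false -- mandated namespace `Summit.<Summit>.<Problem>` of this single-conjunct summit
set_option linter.overlappingInstances false -- signatures carry `[IsDomain O] [IsDiscreteValuationRing O]`

noncomputable section

open CategoryTheory CategoryTheory.Limits AlgebraicGeometry TopologicalSpace Topology IsLocalRing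
open Literature.AlgebraicGeometry.Resolution
open AlgebraicGeometry.Scheme.IdealSheafData
open Summit.ResolutionOfSingularities.ResolutionOfSingularities.Theses.EquisingularLift.Split
open Summit.ResolutionOfSingularities.ResolutionOfSingularities.Cruxes.EquisingularLift.StrataSplit

namespace Summit.ResolutionOfSingularities.ResolutionOfSingularities.Cruxes.EquisingularLiftNat.Sections

/-- **(C)SL — the centred in-carrier point step at `TCPlus.MemberSL`** (see the module docstring). [cite: Matsumura1987, Thm. 14.2 and Thm. 20.3]
[cite: GortzWedhorn2020, Prop. 13.91 and Prop. 13.96] [cite: Liu2002, Thm. 8.1.19] [cite: StacksProject, Tag 01WS] [OURS · L1 W4.5b · T23-A‴ (U6)] brick (F5b)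
(stmt-ResolutionOfSingularities-20148); NOT a statement of the manuscript. -/
theorem memberSL_strictTransform_of_centredPoint (O : Type) [CommRing O] [IsDomain O] [IsDiscreteValuationRing O]
    (k : Type) [Field k] (θ : O →+* k) (hθ : Function.Surjective θ)
    (P : Scheme.{0}) [IsIntegral P] (q : P ⟶ Spec (.of O)) [IsProper q] [SmoothOfRelativeDimension 3 q]
    (Y : Set P) (hYsp : Y ⊆ q ⁻¹' {closedPoint O}) (hYirr : IsIrreducible Y) (hYcl : IsClosed Y)
    (hPnoeth : IsLocallyNoetherian P) (hPreg : Scheme.IsRegular P)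
    (Ch : ∀ X' : Scheme.{0}, (X' ⟶ P) → Set X' → Prop)
    (hChain : ∀ (X' : Scheme.{0}) (σ : X' ⟶ P) (S : Set X'), Ch X' σ S → Chain P Y X' σ S)
    (hStep : ∀ (X' X'' : Scheme.{0}) (σ' : X' ⟶ P) (S' : Set X') (C : X'.IdealSheafData) (τ : X'' ⟶ X'),
      Ch X' σ' S' → IsBlowup τ C → Scheme.IsRegular C.subscheme → Flat (C.subschemeι ≫ σ' ≫ q) →
      σ' '' (C.support : Set X') ⊆ {x : P | ¬ IsGenericPoint x Y} →
      (C.support : Set X') ∩ (σ' ≫ q) ⁻¹' {closedPoint O} ⊆ S' →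
      Ch X'' (τ ≫ σ') (closure (τ ⁻¹' (S' \ (C.support : Set X')))))
    (G : Scheme.{0}) [IsIntegral G] (T Z Kd Sd : Set G) (x : G) (hx : IsClosed ({x} : Set G)) (hxT : x ∈ T) (hTx : ¬ T ⊆ {x})
    (Ls : List (Set G)) (hmem : TCPlus.MemberSL O k θ P q Y Ch G T Z Kd Sd Ls {x}) (hLcl : ∀ L ∈ Ls, IsClosed L)
    (hxZ : x ∈ closure Z) (hamb : IsRegularLocalRing (G.presheaf.stalk x)) (hZcl : IsClosed Z)
    (G₂ : Scheme.{0}) (υ : G₂ ⟶ G) (hυ : IsBlowup υ (vanishingIdeal ⟨{x}, hx⟩)) :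
    IsIntegral G₂ ∧ IsIrreducible (closure (υ ⁻¹' (T \ {x}))) ∧
      ∀ Ls' : List (Set G₂), (∀ L' ∈ Ls', L' = υ ⁻¹' {x} ∨ ∃ L ∈ Ls, x ∉ L ∧ L' = closure (υ ⁻¹' (L \ {x}))) →
        (∀ L' ∈ Ls', IsClosed L') ∧
        TCPlus.MemberSL O k θ P q Y Ch G₂ (closure (υ ⁻¹' (T \ {x}))) (closure (υ ⁻¹' (Z \ {x})))
          (closure (υ ⁻¹' (Kd \ {x}))) (closure (υ ⁻¹' (Sd \ {x}))) Ls' ∅ := by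
  classical
  obtain ⟨X, σ, S, j, t, 𝓢, K, hmemAt, hLs⟩ := hmem
  obtain ⟨s, X₂, τ, j₂, t₂, hs, hsx, hτ, hcomm, hCb, hG₂int, hirr₂, hmem₂⟩ :=
    memberSAt_strictTransform_of_centredPoint O k θ hθ P q Y hYsp hYirr hYcl hPnoeth hPreg Ch hChain hStep G T Z Kd Sd x hx hxT hTx X σ S
      j t 𝓢 K hmemAt hZcl G₂ υ hυ
  obtain ⟨hCh, hXint, hXnoeth, hXreg, -, hsq, -, hi, -, -, -, hiv, -, -, -, -, -, -⟩ := hmemAt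
  haveI := hXint
  haveI := hXnoeth
  -- the old stage: proper over `O`, `j` a closed immersion, the point on `V(𝓢 ⊔ K)` hence off the generic point of `Y`
  obtain ⟨-, -, hσ⟩ := chain_isRegular P Y X σ S (hChain _ _ _ hCh) hPnoeth hPreg
  haveI := hσ
  haveI : IsProper (σ ≫ q) := inferInstance
  haveI : IsClosedImmersion (Spec.map (CommRingCat.ofHom θ)) := IsClosedImmersion.spec_of_surjective _ hθ
  haveI hjci : IsClosedImmersion j := MorphismProperty.IsStableUnderBaseChange.of_isPullback hsq.flip inferInstance
  haveI : IsLocallyNoetherian G := LocallyOfFiniteType.isLocallyNoetherian j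
  have hxC : j x ∈ ((𝓢 ⊔ K).support : Set X) := by
    have h1 : x ∈ (((𝓢 ⊔ K).comap j).support : Set G) := by
      rw [hi, Scheme.IdealSheafData.coe_support_vanishingIdeal]; exact hxZ
    rw [Scheme.IdealSheafData.support_comap] at h1
    exact h1
  have hw : ¬ IsGenericPoint (σ (j x)) Y := hiv ⟨j x, hxC, rfl⟩
  -- (F1) the new plane with its model; (a) the away letters; the `{j x}`-fibre disjointness
  have hnew : TCPlus.LetterDatum O P q Y G₂ X₂ (τ ≫ σ) j₂ (υ ⁻¹' {x}) :=
    TCPlus.letterDatum_newPlane O hθ P q Y hYsp hXreg hsq hs hx hsx hw hamb hτ hυ hcomm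
  have hdisj : ∀ I : X.IdealSheafData, j x ∉ (I.support : Set X) → Disjoint (I.support : Set X) (s.ker.support : Set X) :=
    fun I hI => disjoint_support_of_inter_fibre_eq_singleton (σ ≫ q) s.ker I hCb hI
  have hJ : (((vanishingIdeal ⟨{x}, hx⟩ : G.IdealSheafData)).support : Set G) = {x} :=
    Scheme.IdealSheafData.coe_support_vanishingIdeal _
  have haway := TCPlus.letters_transport_away O P q Y hτ hυ hJ hcomm hdisj (fun L hL => ⟨hLcl L hL, hLs L hL⟩)
  refine ⟨hG₂int, hirr₂, fun Ls' hLs' => ⟨fun L' hL' => ?_, X₂, τ ≫ σ, _, j₂, t₂, _, _, hmem₂, fun L' hL' => ?_⟩⟩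
  · rcases hLs' L' hL' with rfl | ⟨L, -, -, rfl⟩
    · exact hx.preimage υ.continuous
    · exact isClosed_closure
  · rcases hLs' L' hL' with rfl | ⟨L, hL, hxL, rfl⟩
    · exact hnew
    · exact haway L hL hxL

end Summit.ResolutionOfSingularities.ResolutionOfSingularities.Cruxes.EquisingularLiftNat.Sections

end
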